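import Mathlib
import HarnessLib

/-!
# `NoHeavyLowerTail` (stmt-CriticalPhenomena-4575) — two-port peeling: the comonotone certificate at level `j ≤ 2` (algebraic core)

Route `PercNearOneGluingNoHeavy`, seat `prim-gen-swap` (gen 5); memo TWO-PORT-PEELING.md §5 (P2), §6.  The last input of the MS-STAR₂₂ theorem is
the inequality E∅∅ ≥ θ_u·K_a + θ_v(1−θ_u)·K_b ("merge stability for two comonotone two-port stars" dominated by two champion rows).  At
level `j ≤ 2` every indicator in E∅∅, K_a, K_b is an explicit function of nine 0/1 quantities of the configuration (memo §6: `σ = [|π(c)| ≤ j]`,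
`α₁ = [|π(a)| ≤ j]`, `α₂ = [|π(a) ∪ π(a')| ≤ j]`, `β₁, β₂` likewise, `x = [c ∉ π(a) ∪ π(a')]`, `y = [c ∉ π(b) ∪ π(b')]`, `ι_a = [a ∈ π(b) ∪ π(b')]`,
`ι_b = [b ∈ π(a) ∪ π(a')]`), subject only to `α₂ ≤ α₁(1 − ι_a)` and `β₂ ≤ β₁(1 − ι_b)`.  This file proves the resulting polynomial inequality for
ALL reals in `[0,1]` (and, appended, its abstract pointwise form over eighteen events `comonotone_pointwise_abstract`) (so it integrates to the measure statement by linearity):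
`E − t·K_a − s(1−t)·K_b = (1−t)(1−s)·σ·X·Y + t(1−t)(A₁α₁ − α₂) + t s α₂ + s(1−t)(1−s)(B₁β₁ − β₂) ≥ 0`
with `X = 1 − t(1−x)`, `Y = 1 − s(1−y)`, `A₁ = 1 − s ι_a`, `B₁ = 1 − t ι_b`.  No definitions, no named facts, no sorries.
-/

namespace Summit.CriticalPhenomena.PercolationContinuityZ3.Theorems

namespace TwoPortPeeling

/-- **The comonotone certificate, algebraic core (level `j ≤ 2`).**  For `t, s ∈ [0,1]`, `σ, α₁, α₂, β₁, x, y, ι_a, ι_b ≥ 0` (any `β₂`) with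
`α₂ ≤ α₁(1 − ι_a)`, `β₂ ≤ β₁(1 − ι_b)`:  with
`E  = (1−t)(1−s)σ + t(1−s)(xσ − α₂) + (1−t)s(yσ − β₂) + ts·xyσ`,
`Ka = (1−t)(1−s)(σ − α₁) + t(1−s)(xσ − α₂) + (1−t)s(yσ − (1−ι_a)α₁) + ts(xyσ − α₂)`,
`Kb = (1−t)(1−s)(σ − β₁) + t(1−s)(xσ − (1−ι_b)β₁) + (1−t)s(yσ − β₂) + ts(xyσ − β₂)`,
one has `t·Ka + s(1−t)·Kb ≤ E`. [this file] -/
theorem comonotone_certificate_algebra (t s σ α₁ α₂ β₁ β₂ x y ιa ιb : ℝ)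
    (ht0 : 0 ≤ t) (ht1 : t ≤ 1) (hs0 : 0 ≤ s) (hs1 : s ≤ 1)
    (hσ0 : 0 ≤ σ) (hα10 : 0 ≤ α₁) (hα20 : 0 ≤ α₂) (hβ10 : 0 ≤ β₁)
    (hx0 : 0 ≤ x) (hy0 : 0 ≤ y) (hιa0 : 0 ≤ ιa) (hιb0 : 0 ≤ ιb)
    (hα : α₂ ≤ α₁ * (1 - ιa)) (hβ : β₂ ≤ β₁ * (1 - ιb)) :
    t * ((1 - t) * (1 - s) * (σ - α₁) + t * (1 - s) * (x * σ - α₂) + (1 - t) * s * (y * σ - (1 - ιa) * α₁) +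
          t * s * (x * y * σ - α₂)) +
      s * (1 - t) * ((1 - t) * (1 - s) * (σ - β₁) + t * (1 - s) * (x * σ - (1 - ιb) * β₁) + (1 - t) * s * (y * σ - β₂) +
          t * s * (x * y * σ - β₂)) ≤
      (1 - t) * (1 - s) * σ + t * (1 - s) * (x * σ - α₂) + (1 - t) * s * (y * σ - β₂) + t * s * (x * y * σ) := by
  -- the four nonnegative pieces of the slack
  have hX : 0 ≤ 1 - t * (1 - x) := by nlinarith
  have hY : 0 ≤ 1 - s * (1 - y) := by nlinarith
  have p1 : 0 ≤ (1 - t) * (1 - s) * σ * ((1 - t * (1 - x)) * (1 - s * (1 - y))) :=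
    mul_nonneg (mul_nonneg (mul_nonneg (sub_nonneg.2 ht1) (sub_nonneg.2 hs1)) hσ0) (mul_nonneg hX hY)
  have hA : 0 ≤ (1 - s * ιa) * α₁ - α₂ := by nlinarith [mul_nonneg hα10 hιa0, mul_nonneg (sub_nonneg.2 hs1) (mul_nonneg hα10 hιa0)]
  have p2 : 0 ≤ t * (1 - t) * ((1 - s * ιa) * α₁ - α₂) := mul_nonneg (mul_nonneg ht0 (sub_nonneg.2 ht1)) hA
  have p3 : 0 ≤ t * s * α₂ := mul_nonneg (mul_nonneg ht0 hs0) hα20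
  have hB : 0 ≤ (1 - t * ιb) * β₁ - β₂ := by nlinarith [mul_nonneg hβ10 hιb0, mul_nonneg (sub_nonneg.2 ht1) (mul_nonneg hβ10 hιb0)]
  have p4 : 0 ≤ s * (1 - t) * (1 - s) * ((1 - t * ιb) * β₁ - β₂) :=
    mul_nonneg (mul_nonneg (mul_nonneg hs0 (sub_nonneg.2 ht1)) (sub_nonneg.2 hs1)) hB
  have key : (1 - t) * (1 - s) * σ + t * (1 - s) * (x * σ - α₂) + (1 - t) * s * (y * σ - β₂) + t * s * (x * y * σ) -
      (t * ((1 - t) * (1 - s) * (σ - α₁) + t * (1 - s) * (x * σ - α₂) + (1 - t) * s * (y * σ - (1 - ιa) * α₁) +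
          t * s * (x * y * σ - α₂)) +
        s * (1 - t) * ((1 - t) * (1 - s) * (σ - β₁) + t * (1 - s) * (x * σ - (1 - ιb) * β₁) + (1 - t) * s * (y * σ - β₂) +
          t * s * (x * y * σ - β₂))) =
      (1 - t) * (1 - s) * σ * ((1 - t * (1 - x)) * (1 - s * (1 - y))) + t * (1 - t) * ((1 - s * ιa) * α₁ - α₂) +
        t * s * α₂ + s * (1 - t) * (1 - s) * ((1 - t * ιb) * β₁ - β₂) := by
    ring
  linarith [p1, p2, p3, p4, key]

open scoped Classical in
/-- Indicator identities of the comonotone certificate, group 1 (generated; level-2 translation in abstract form). [this file] -/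
theorem comonotone_indicators_1 {Ω : Type*} (ω : Ω) (CA SA SA2 SBB SC : Prop) (E0c E0a E0b E0L EUc EUa : Set Ω)
    (hE0c : ω ∈ E0c ↔ SC)
    (hE0a : ω ∈ E0a ↔ SA)
    (hE0b : ω ∈ E0b ↔ SBB)
    (hE0L : ω ∈ E0L ↔ False)
    (hEUc : ω ∈ EUc ↔ (¬ CA ∧ SC))
    (hEUa : ω ∈ EUa ↔ SA2) :
    Set.indicator E0c (1 : Ω → ℝ) ω = (if SC then (1 : ℝ) else 0) ∧
    Set.indicator E0a (1 : Ω → ℝ) ω = (if SA then (1 : ℝ) else 0) ∧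
    Set.indicator E0b (1 : Ω → ℝ) ω = (if SBB then (1 : ℝ) else 0) ∧
    Set.indicator E0L (1 : Ω → ℝ) ω = 0 ∧
    Set.indicator EUc (1 : Ω → ℝ) ω = (if CA then (0 : ℝ) else 1) * (if SC then (1 : ℝ) else 0) ∧
    Set.indicator EUa (1 : Ω → ℝ) ω = (if SA2 then (1 : ℝ) else 0) := by
  classical
  have I_E0c : Set.indicator E0c (1 : Ω → ℝ) ω = (if SC then (1 : ℝ) else 0) := by
    by_cases HSC : SC
    · rw [Set.indicator_of_mem ((hE0c).2 HSC)]
      simp [HSC]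
    · rw [Set.indicator_of_notMem (fun h => HSC (((hE0c).1 h)))]
      simp [HSC]
  have I_E0a : Set.indicator E0a (1 : Ω → ℝ) ω = (if SA then (1 : ℝ) else 0) := by
    by_cases HSA : SA
    · rw [Set.indicator_of_mem ((hE0a).2 HSA)]
      simp [HSA]
    · rw [Set.indicator_of_notMem (fun h => HSA (((hE0a).1 h)))]
      simp [HSA]
  have I_E0b : Set.indicator E0b (1 : Ω → ℝ) ω = (if SBB then (1 : ℝ) else 0) := by
    by_cases HSBB : SBB
    · rw [Set.indicator_of_mem ((hE0b).2 HSBB)]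
      simp [HSBB]
    · rw [Set.indicator_of_notMem (fun h => HSBB (((hE0b).1 h)))]
      simp [HSBB]
  have I_E0L : Set.indicator E0L (1 : Ω → ℝ) ω = 0 := by
    rw [Set.indicator_of_notMem (fun h => (hE0L).1 h)]
  have I_EUc : Set.indicator EUc (1 : Ω → ℝ) ω = (if CA then (0 : ℝ) else 1) * (if SC then (1 : ℝ) else 0) := by
    by_cases HCA : CA
    · by_cases HSC : SC
      · rw [Set.indicator_of_notMem (fun h => (((hEUc).1 h).1) HCA)]
        simp [HCA, HSC]
      · rw [Set.indicator_of_notMem (fun h => (((hEUc).1 h).1) HCA)]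
        simp [HCA, HSC]
    · by_cases HSC : SC
      · rw [Set.indicator_of_mem ((hEUc).2 ⟨HCA, HSC⟩)]
        simp [HCA, HSC]
      · rw [Set.indicator_of_notMem (fun h => HSC (((hEUc).1 h).2))]
        simp [HCA, HSC]
  have I_EUa : Set.indicator EUa (1 : Ω → ℝ) ω = (if SA2 then (1 : ℝ) else 0) := by
    by_cases HSA2 : SA2
    · rw [Set.indicator_of_mem ((hEUa).2 HSA2)]
      simp [HSA2]
    · rw [Set.indicator_of_notMem (fun h => HSA2 (((hEUa).1 h)))]
      simp [HSA2]
  exact ⟨I_E0c, I_E0a, I_E0b, I_E0L, I_EUc, I_EUa⟩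

open scoped Classical in
/-- Indicator identities of the comonotone certificate, group 2 (generated; level-2 translation in abstract form). [this file] -/
theorem comonotone_indicators_2 {Ω : Type*} (ω : Ω) (AB BA CB SA SA2 SB2 SBB SC : Prop) (EUb EUL EVc EVa EVb EVr : Set Ω)
    (hEUb : ω ∈ EUb ↔ (¬ BA ∧ SBB))
    (hEUL : ω ∈ EUL ↔ SA2)
    (hEVc : ω ∈ EVc ↔ (¬ CB ∧ SC))
    (hEVa : ω ∈ EVa ↔ (¬ AB ∧ SA))
    (hEVb : ω ∈ EVb ↔ SB2)
    (hEVr : ω ∈ EVr ↔ (¬ CB ∧ SC)) :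
    Set.indicator EUb (1 : Ω → ℝ) ω = (if BA then (0 : ℝ) else 1) * (if SBB then (1 : ℝ) else 0) ∧
    Set.indicator EUL (1 : Ω → ℝ) ω = (if SA2 then (1 : ℝ) else 0) ∧
    Set.indicator EVc (1 : Ω → ℝ) ω = (if CB then (0 : ℝ) else 1) * (if SC then (1 : ℝ) else 0) ∧
    Set.indicator EVa (1 : Ω → ℝ) ω = (if AB then (0 : ℝ) else 1) * (if SA then (1 : ℝ) else 0) ∧
    Set.indicator EVb (1 : Ω → ℝ) ω = (if SB2 then (1 : ℝ) else 0) ∧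
    Set.indicator EVr (1 : Ω → ℝ) ω = (if CB then (0 : ℝ) else 1) * (if SC then (1 : ℝ) else 0) := by
  classical
  have I_EUb : Set.indicator EUb (1 : Ω → ℝ) ω = (if BA then (0 : ℝ) else 1) * (if SBB then (1 : ℝ) else 0) := by
    by_cases HBA : BA
    · by_cases HSBB : SBB
      · rw [Set.indicator_of_notMem (fun h => (((hEUb).1 h).1) HBA)]
        simp [HBA, HSBB]
      · rw [Set.indicator_of_notMem (fun h => (((hEUb).1 h).1) HBA)]
        simp [HBA, HSBB]
    · by_cases HSBB : SBB
      · rw [Set.indicator_of_mem ((hEUb).2 ⟨HBA, HSBB⟩)]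
        simp [HBA, HSBB]
      · rw [Set.indicator_of_notMem (fun h => HSBB (((hEUb).1 h).2))]
        simp [HBA, HSBB]
  have I_EUL : Set.indicator EUL (1 : Ω → ℝ) ω = (if SA2 then (1 : ℝ) else 0) := by
    by_cases HSA2 : SA2
    · rw [Set.indicator_of_mem ((hEUL).2 HSA2)]
      simp [HSA2]
    · rw [Set.indicator_of_notMem (fun h => HSA2 (((hEUL).1 h)))]
      simp [HSA2]
  have I_EVc : Set.indicator EVc (1 : Ω → ℝ) ω = (if CB then (0 : ℝ) else 1) * (if SC then (1 : ℝ) else 0) := by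
    by_cases HCB : CB
    · by_cases HSC : SC
      · rw [Set.indicator_of_notMem (fun h => (((hEVc).1 h).1) HCB)]
        simp [HCB, HSC]
      · rw [Set.indicator_of_notMem (fun h => (((hEVc).1 h).1) HCB)]
        simp [HCB, HSC]
    · by_cases HSC : SC
      · rw [Set.indicator_of_mem ((hEVc).2 ⟨HCB, HSC⟩)]
        simp [HCB, HSC]
      · rw [Set.indicator_of_notMem (fun h => HSC (((hEVc).1 h).2))]
        simp [HCB, HSC]
  have I_EVa : Set.indicator EVa (1 : Ω → ℝ) ω = (if AB then (0 : ℝ) else 1) * (if SA then (1 : ℝ) else 0) := by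
    by_cases HAB : AB
    · by_cases HSA : SA
      · rw [Set.indicator_of_notMem (fun h => (((hEVa).1 h).1) HAB)]
        simp [HAB, HSA]
      · rw [Set.indicator_of_notMem (fun h => (((hEVa).1 h).1) HAB)]
        simp [HAB, HSA]
    · by_cases HSA : SA
      · rw [Set.indicator_of_mem ((hEVa).2 ⟨HAB, HSA⟩)]
        simp [HAB, HSA]
      · rw [Set.indicator_of_notMem (fun h => HSA (((hEVa).1 h).2))]
        simp [HAB, HSA]
  have I_EVb : Set.indicator EVb (1 : Ω → ℝ) ω = (if SB2 then (1 : ℝ) else 0) := by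
    by_cases HSB2 : SB2
    · rw [Set.indicator_of_mem ((hEVb).2 HSB2)]
      simp [HSB2]
    · rw [Set.indicator_of_notMem (fun h => HSB2 (((hEVb).1 h)))]
      simp [HSB2]
  have I_EVr : Set.indicator EVr (1 : Ω → ℝ) ω = (if CB then (0 : ℝ) else 1) * (if SC then (1 : ℝ) else 0) := by
    by_cases HCB : CB
    · by_cases HSC : SC
      · rw [Set.indicator_of_notMem (fun h => (((hEVr).1 h).1) HCB)]
        simp [HCB, HSC]
      · rw [Set.indicator_of_notMem (fun h => (((hEVr).1 h).1) HCB)]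
        simp [HCB, HSC]
    · by_cases HSC : SC
      · rw [Set.indicator_of_mem ((hEVr).2 ⟨HCB, HSC⟩)]
        simp [HCB, HSC]
      · rw [Set.indicator_of_notMem (fun h => HSC (((hEVr).1 h).2))]
        simp [HCB, HSC]
  exact ⟨I_EUb, I_EUL, I_EVc, I_EVa, I_EVb, I_EVr⟩

open scoped Classical in
/-- Indicator identities of the comonotone certificate, group 3 (generated; level-2 translation in abstract form). [this file] -/
theorem comonotone_indicators_3 {Ω : Type*} (ω : Ω) (CA CB SA2 SB2 SC : Prop) (EVl EWc EWa EWb EWr EWl : Set Ω)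
    (hEVl : ω ∈ EVl ↔ (¬ CB ∧ SB2))
    (hEWc : ω ∈ EWc ↔ (¬ CA ∧ ¬ CB ∧ SC))
    (hEWa : ω ∈ EWa ↔ SA2)
    (hEWb : ω ∈ EWb ↔ SB2)
    (hEWr : ω ∈ EWr ↔ (¬ CA ∧ ¬ CB ∧ SC))
    (hEWl : ω ∈ EWl ↔ False) :
    Set.indicator EVl (1 : Ω → ℝ) ω = (if CB then (0 : ℝ) else 1) * (if SB2 then (1 : ℝ) else 0) ∧
    Set.indicator EWc (1 : Ω → ℝ) ω = (if CA then (0 : ℝ) else 1) * (if CB then (0 : ℝ) else 1) * (if SC then (1 : ℝ) else 0) ∧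
    Set.indicator EWa (1 : Ω → ℝ) ω = (if SA2 then (1 : ℝ) else 0) ∧
    Set.indicator EWb (1 : Ω → ℝ) ω = (if SB2 then (1 : ℝ) else 0) ∧
    Set.indicator EWr (1 : Ω → ℝ) ω = (if CA then (0 : ℝ) else 1) * (if CB then (0 : ℝ) else 1) * (if SC then (1 : ℝ) else 0) ∧
    Set.indicator EWl (1 : Ω → ℝ) ω = 0 := by
  classical
  have I_EVl : Set.indicator EVl (1 : Ω → ℝ) ω = (if CB then (0 : ℝ) else 1) * (if SB2 then (1 : ℝ) else 0) := by
    by_cases HCB : CB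
    · by_cases HSB2 : SB2
      · rw [Set.indicator_of_notMem (fun h => (((hEVl).1 h).1) HCB)]
        simp [HCB, HSB2]
      · rw [Set.indicator_of_notMem (fun h => (((hEVl).1 h).1) HCB)]
        simp [HCB, HSB2]
    · by_cases HSB2 : SB2
      · rw [Set.indicator_of_mem ((hEVl).2 ⟨HCB, HSB2⟩)]
        simp [HCB, HSB2]
      · rw [Set.indicator_of_notMem (fun h => HSB2 (((hEVl).1 h).2))]
        simp [HCB, HSB2]
  have I_EWc : Set.indicator EWc (1 : Ω → ℝ) ω = (if CA then (0 : ℝ) else 1) * (if CB then (0 : ℝ) else 1) * (if SC then (1 : ℝ) else 0) := by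
    by_cases HCA : CA
    · by_cases HCB : CB
      · by_cases HSC : SC
        · rw [Set.indicator_of_notMem (fun h => (((hEWc).1 h).1) HCA)]
          simp [HCA, HCB, HSC]
        · rw [Set.indicator_of_notMem (fun h => (((hEWc).1 h).1) HCA)]
          simp [HCA, HCB, HSC]
      · by_cases HSC : SC
        · rw [Set.indicator_of_notMem (fun h => (((hEWc).1 h).1) HCA)]
          simp [HCA, HCB, HSC]
        · rw [Set.indicator_of_notMem (fun h => (((hEWc).1 h).1) HCA)]
          simp [HCA, HCB, HSC]
    · by_cases HCB : CB
      · by_cases HSC : SC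
        · rw [Set.indicator_of_notMem (fun h => (((hEWc).1 h).2.1) HCB)]
          simp [HCA, HCB, HSC]
        · rw [Set.indicator_of_notMem (fun h => (((hEWc).1 h).2.1) HCB)]
          simp [HCA, HCB, HSC]
      · by_cases HSC : SC
        · rw [Set.indicator_of_mem ((hEWc).2 ⟨HCA, HCB, HSC⟩)]
          simp [HCA, HCB, HSC]
        · rw [Set.indicator_of_notMem (fun h => HSC (((hEWc).1 h).2.2))]
          simp [HCA, HCB, HSC]
  have I_EWa : Set.indicator EWa (1 : Ω → ℝ) ω = (if SA2 then (1 : ℝ) else 0) := by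
    by_cases HSA2 : SA2
    · rw [Set.indicator_of_mem ((hEWa).2 HSA2)]
      simp [HSA2]
    · rw [Set.indicator_of_notMem (fun h => HSA2 (((hEWa).1 h)))]
      simp [HSA2]
  have I_EWb : Set.indicator EWb (1 : Ω → ℝ) ω = (if SB2 then (1 : ℝ) else 0) := by
    by_cases HSB2 : SB2
    · rw [Set.indicator_of_mem ((hEWb).2 HSB2)]
      simp [HSB2]
    · rw [Set.indicator_of_notMem (fun h => HSB2 (((hEWb).1 h)))]
      simp [HSB2]
  have I_EWr : Set.indicator EWr (1 : Ω → ℝ) ω = (if CA then (0 : ℝ) else 1) * (if CB then (0 : ℝ) else 1) * (if SC then (1 : ℝ) else 0) := by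
    by_cases HCA : CA
    · by_cases HCB : CB
      · by_cases HSC : SC
        · rw [Set.indicator_of_notMem (fun h => (((hEWr).1 h).1) HCA)]
          simp [HCA, HCB, HSC]
        · rw [Set.indicator_of_notMem (fun h => (((hEWr).1 h).1) HCA)]
          simp [HCA, HCB, HSC]
      · by_cases HSC : SC
        · rw [Set.indicator_of_notMem (fun h => (((hEWr).1 h).1) HCA)]
          simp [HCA, HCB, HSC]
        · rw [Set.indicator_of_notMem (fun h => (((hEWr).1 h).1) HCA)]
          simp [HCA, HCB, HSC]
    · by_cases HCB : CB
      · by_cases HSC : SC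
        · rw [Set.indicator_of_notMem (fun h => (((hEWr).1 h).2.1) HCB)]
          simp [HCA, HCB, HSC]
        · rw [Set.indicator_of_notMem (fun h => (((hEWr).1 h).2.1) HCB)]
          simp [HCA, HCB, HSC]
      · by_cases HSC : SC
        · rw [Set.indicator_of_mem ((hEWr).2 ⟨HCA, HCB, HSC⟩)]
          simp [HCA, HCB, HSC]
        · rw [Set.indicator_of_notMem (fun h => HSC (((hEWr).1 h).2.2))]
          simp [HCA, HCB, HSC]
  have I_EWl : Set.indicator EWl (1 : Ω → ℝ) ω = 0 := by
    rw [Set.indicator_of_notMem (fun h => (hEWl).1 h)]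
  exact ⟨I_EVl, I_EWc, I_EWa, I_EWb, I_EWr, I_EWl⟩

open scoped Classical in
/-- **Comonotone certificate, abstract pointwise form (level `j ≤ 2`).**  If the eighteen events of the certificate (loneliness of `c, a, b`, the
observer events of `u`, and the CS₂ pair events, read in the four glued worlds) have memberships at `ω` given by nine elementary propositions as in
the level-2 translation — `SC, SA, SBB` (loneliness of `c, a, b`), `SA2, SB2` (smallness of the glued pairs), `CA, CB, AB, BA` (attachments), with
`SA2 → SA ∧ ¬AB`, `SB2 → SBB ∧ ¬BA` — then `E − t·K_a − s(1−t)·K_b ≥ 0` for the indicator combination.  [this file; `comonotone_certificate_algebra`] -/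
theorem comonotone_pointwise_abstract {Ω : Type*} (ω : Ω) (t s : ℝ) (ht0 : 0 ≤ t) (ht1 : t ≤ 1) (hs0 : 0 ≤ s) (hs1 : s ≤ 1)
    (CA CB AB BA SC SA SBB SA2 SB2 : Prop) (hA2 : SA2 → SA ∧ ¬ AB) (hB2 : SB2 → SBB ∧ ¬ BA)
    (E0c E0a E0b E0L EUc EUa EUb EUL EVc EVa EVb EVr EVl EWc EWa EWb EWr EWl : Set Ω)
    (hE0c : ω ∈ E0c ↔ SC)
    (hE0a : ω ∈ E0a ↔ SA)
    (hE0b : ω ∈ E0b ↔ SBB)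
    (hE0L : ω ∈ E0L ↔ False)
    (hEUc : ω ∈ EUc ↔ (¬ CA ∧ SC))
    (hEUa : ω ∈ EUa ↔ SA2)
    (hEUb : ω ∈ EUb ↔ (¬ BA ∧ SBB))
    (hEUL : ω ∈ EUL ↔ SA2)
    (hEVc : ω ∈ EVc ↔ (¬ CB ∧ SC))
    (hEVa : ω ∈ EVa ↔ (¬ AB ∧ SA))
    (hEVb : ω ∈ EVb ↔ SB2)
    (hEVr : ω ∈ EVr ↔ (¬ CB ∧ SC))
    (hEVl : ω ∈ EVl ↔ (¬ CB ∧ SB2))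
    (hEWc : ω ∈ EWc ↔ (¬ CA ∧ ¬ CB ∧ SC))
    (hEWa : ω ∈ EWa ↔ SA2)
    (hEWb : ω ∈ EWb ↔ SB2)
    (hEWr : ω ∈ EWr ↔ (¬ CA ∧ ¬ CB ∧ SC))
    (hEWl : ω ∈ EWl ↔ False) :
    0 ≤ (((1 - t) * (1 - s)) * Set.indicator E0c (1 : Ω → ℝ) ω - ((1 - t) * (1 - s)) * Set.indicator E0L (1 : Ω → ℝ) ω + ((1 - t) * s) * Set.indicator EVr (1 : Ω → ℝ) ω - ((1 - t) * s) * Set.indicator EVl (1 : Ω → ℝ) ω + (t * (1 - s)) * Set.indicator EUc (1 : Ω → ℝ) ω - (t * (1 - s)) * Set.indicator EUL (1 : Ω → ℝ) ω + (t * s) * Set.indicator EWr (1 : Ω → ℝ) ω - (t * s) * Set.indicator EWl (1 : Ω → ℝ) ω) -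
      t * (((1 - t) * (1 - s)) * Set.indicator E0c (1 : Ω → ℝ) ω - ((1 - t) * (1 - s)) * Set.indicator E0a (1 : Ω → ℝ) ω + (t * (1 - s)) * Set.indicator EUc (1 : Ω → ℝ) ω - (t * (1 - s)) * Set.indicator EUa (1 : Ω → ℝ) ω + ((1 - t) * s) * Set.indicator EVc (1 : Ω → ℝ) ω - ((1 - t) * s) * Set.indicator EVa (1 : Ω → ℝ) ω + (t * s) * Set.indicator EWc (1 : Ω → ℝ) ω - (t * s) * Set.indicator EWa (1 : Ω → ℝ) ω) -
      s * (1 - t) * (((1 - t) * (1 - s)) * Set.indicator E0c (1 : Ω → ℝ) ω - ((1 - t) * (1 - s)) * Set.indicator E0b (1 : Ω → ℝ) ω + (t * (1 - s)) * Set.indicator EUc (1 : Ω → ℝ) ω - (t * (1 - s)) * Set.indicator EUb (1 : Ω → ℝ) ω + ((1 - t) * s) * Set.indicator EVc (1 : Ω → ℝ) ω - ((1 - t) * s) * Set.indicator EVb (1 : Ω → ℝ) ω + (t * s) * Set.indicator EWc (1 : Ω → ℝ) ω - (t * s) * Set.indicator EWb (1 : Ω → ℝ) ω) := by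
  classical
  obtain ⟨I1, I2, I3, I4, I5, I6⟩ := comonotone_indicators_1 ω CA SA SA2 SBB SC E0c E0a E0b E0L EUc EUa hE0c hE0a hE0b hE0L hEUc hEUa
  obtain ⟨I7, I8, I9, I10, I11, I12⟩ := comonotone_indicators_2 ω AB BA CB SA SA2 SB2 SBB SC EUb EUL EVc EVa EVb EVr hEUb hEUL hEVc hEVa hEVb hEVr
  obtain ⟨I13, I14, I15, I16, I17, I18⟩ := comonotone_indicators_3 ω CA CB SA2 SB2 SC EVl EWc EWa EWb EWr EWl hEVl hEWc hEWa hEWb hEWr hEWl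
  rw [I1, I2, I3, I4, I5, I6, I7, I8, I9, I10, I11, I12, I13, I14, I15, I16, I17, I18]
  obtain ⟨σ, hσ⟩ : ∃ σ : ℝ, σ = if SC then 1 else 0 := ⟨_, rfl⟩
  obtain ⟨α₁, hα₁⟩ : ∃ x : ℝ, x = if SA then 1 else 0 := ⟨_, rfl⟩
  obtain ⟨β₁, hβ₁⟩ : ∃ x : ℝ, x = if SBB then 1 else 0 := ⟨_, rfl⟩
  obtain ⟨α₂, hα₂⟩ : ∃ x : ℝ, x = if SA2 then 1 else 0 := ⟨_, rfl⟩
  obtain ⟨β₂, hβ₂⟩ : ∃ x : ℝ, x = if SB2 then 1 else 0 := ⟨_, rfl⟩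
  obtain ⟨xx, hxx⟩ : ∃ x : ℝ, x = if CA then 0 else 1 := ⟨_, rfl⟩
  obtain ⟨yy, hyy⟩ : ∃ x : ℝ, x = if CB then 0 else 1 := ⟨_, rfl⟩
  obtain ⟨ia, hia⟩ : ∃ x : ℝ, x = if AB then 0 else 1 := ⟨_, rfl⟩
  obtain ⟨ib, hib⟩ : ∃ x : ℝ, x = if BA then 0 else 1 := ⟨_, rfl⟩
  rw [← hσ, ← hα₁, ← hβ₁, ← hα₂, ← hβ₂, ← hxx, ← hyy, ← hia, ← hib]
  have hσ0 : 0 ≤ σ := by rw [hσ]; split_ifs <;> norm_num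
  have hα10 : 0 ≤ α₁ := by rw [hα₁]; split_ifs <;> norm_num
  have hα20 : 0 ≤ α₂ := by rw [hα₂]; split_ifs <;> norm_num
  have hβ10 : 0 ≤ β₁ := by rw [hβ₁]; split_ifs <;> norm_num
  have hβ20 : 0 ≤ β₂ := by rw [hβ₂]; split_ifs <;> norm_num
  have hx0 : 0 ≤ xx := by rw [hxx]; split_ifs <;> norm_num
  have hy0 : 0 ≤ yy := by rw [hyy]; split_ifs <;> norm_num
  have hy1 : yy ≤ 1 := by rw [hyy]; split_ifs <;> norm_num
  have hia0 : 0 ≤ 1 - ia := by rw [hia]; split_ifs <;> norm_num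
  have hib0 : 0 ≤ 1 - ib := by rw [hib]; split_ifs <;> norm_num
  have hα : α₂ ≤ α₁ * (1 - (1 - ia)) := by
    by_cases H : SA2
    · obtain ⟨h1, h2⟩ := hA2 H
      rw [hα₂, hα₁, hia, if_pos H, if_pos h1, if_neg h2]; norm_num
    · rw [hα₂, if_neg H]
      have : 0 ≤ ia := by rw [hia]; split_ifs <;> norm_num
      nlinarith [hα10, this]
  have hβ : β₂ ≤ β₁ * (1 - (1 - ib)) := by
    by_cases H : SB2
    · obtain ⟨h1, h2⟩ := hB2 H
      rw [hβ₂, hβ₁, hib, if_pos H, if_pos h1, if_neg h2]; norm_num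
    · rw [hβ₂, if_neg H]
      have : 0 ≤ ib := by rw [hib]; split_ifs <;> norm_num
      nlinarith [hβ10, this]
  have alg := comonotone_certificate_algebra t s σ α₁ α₂ β₁ β₂ xx yy (1 - ia) (1 - ib) ht0 ht1 hs0 hs1 hσ0 hα10 hα20 hβ10 hx0 hy0
    hia0 hib0 hα hβ
  have extra : 0 ≤ (1 - t) * s * ((1 - yy) * β₂) :=
    mul_nonneg (mul_nonneg (sub_nonneg.2 ht1) hs0) (mul_nonneg (sub_nonneg.2 hy1) hβ20)
  linear_combination alg + extra

end TwoPortPeeling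

end Summit.CriticalPhenomena.PercolationContinuityZ3.Theorems
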